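import Summits.FinalStateConjecture.FinalStateConjecture.Theorems.EIHFluxBalanceModulatedKerrHandoffFarConeField

/-!
# Far-cone retardation remainder, III: derivative bound for the transport field

Support file 3 for the brick `SoftEraTubeLift.FarConeRetardationRemainder` of crux
`EIHFluxBalance.ModulatedKerrHandoff` (H′, stmt-FinalStateConjecture-17402; card `soft-era-tube-lift`).
For the transport field `F = η(s)/s + (⟪m, η(s)⟫/(s(1 − ⟪m, c′(s)⟫))) c′(s)` of file II
(`s = ‖y − x‖`, `m = (y − x)/s`): if `‖c′‖ ≤ v < 1`, `‖c″‖ ≤ A`, and the deviation `η` of the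
worldline from its tangent has the Taylor sizes `‖η(s)‖ ≤ A s²`, `‖η′(s)‖ ≤ A s`, then
`‖DF(y) w‖ ≤ (9A + 2A²s)(1 − v)⁻² ‖w‖` (`exists_hasFDerivAt_field_bound`): the derivative of `F` is
`O(A)`, one power of `s` better than `F` itself — the cancellation behind the `O(M·A)` retardation
remainder.  Every piece (`m`, `η(s)`, `c′(s)`, `⟪m, η⟫`, `s(1 − ⟪m, c′⟫)`, its inverse, the quotient)
gets an explicit Fréchet derivative and a pointwise bound.  Mathlib only. [folklore]
-/

noncomputable section

open Filter Topology Metric InnerProductSpace Literature.Geometry.Lorentzian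
open scoped RealInnerProductSpace

-- the doubled `FinalStateConjecture` path component is the summit/problem naming scheme
set_option linter.dupNamespace false

namespace Summit.FinalStateConjecture.FinalStateConjecture.Theorems.EIHFluxBalance.ModulatedKerrHandoffBricks.FarCone

/-! ### The derivative bound -/

section Bound

variable {c η : ℝ → E3} {x y : E3} {v A : ℝ}

/-- **Derivative bound for the transport field.** With `s = ‖y − x‖ > 0`, speed `‖c′‖ ≤ v < 1`,
acceleration `‖c″‖ ≤ A`, and the Taylor sizes `‖η(s)‖ ≤ A s²`, `‖η′(s)‖ ≤ A s` of the deviation of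
a worldline from its tangent: the transport field `F = η(s)/s + (⟪m, η⟫/(s(1 − ⟪m, c′⟫))) c′` has
`‖DF(y) w‖ ≤ (9A + 2A² s)(1 − v)⁻² ‖w‖`. [folklore] -/
theorem exists_hasFDerivAt_field_bound (hc : ContDiff ℝ 2 c) (hη : ContDiff ℝ 1 η)
    (hv0 : 0 ≤ v) (hv1 : v < 1) (hA : 0 ≤ A) (hcv : ∀ s, ‖deriv c s‖ ≤ v)
    (hcA : ∀ s, ‖deriv (deriv c) s‖ ≤ A) (hηA : ‖η ‖y - x‖‖ ≤ A * ‖y - x‖ ^ 2)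
    (hη'A : ‖deriv η ‖y - x‖‖ ≤ A * ‖y - x‖) (hyx : y ≠ x) :
    ∃ L : E3 →L[ℝ] E3, HasFDerivAt (fun y' : E3 ↦ (‖y' - x‖)⁻¹ • η ‖y' - x‖ +
      (⟪(‖y' - x‖)⁻¹ • (y' - x), η ‖y' - x‖⟫ *
        (‖y' - x‖ * (1 - ⟪(‖y' - x‖)⁻¹ • (y' - x), deriv c ‖y' - x‖⟫))⁻¹) • deriv c ‖y' - x‖) L y ∧
      ∀ w, ‖L w‖ ≤ (9 * A + 2 * A ^ 2 * ‖y - x‖) / (1 - v) ^ 2 * ‖w‖ := by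
  have hne : y - x ≠ 0 := sub_ne_zero.2 hyx
  have hpos : 0 < ‖y - x‖ := norm_pos_iff.2 hne
  have h1v : 0 < 1 - v := by linarith
  -- abbreviations for the values at `y`
  set s : ℝ := ‖y - x‖ with hs
  set Ls : E3 →L[ℝ] ℝ := s⁻¹ • innerSL ℝ (y - x) with hLs
  set m : E3 := s⁻¹ • (y - x) with hm
  set e : E3 := η s with he
  set e' : E3 := deriv η s with he'
  set b : E3 := deriv c s with hb
  set b' : E3 := deriv (deriv c) s with hb'
  have hm1 : ‖m‖ = 1 := by
    rw [hm, norm_smul, norm_inv, norm_norm, inv_mul_cancel₀ hpos.ne']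
  have hmb : |⟪m, b⟫| ≤ v := by
    refine (abs_real_inner_le_norm _ _).trans ?_
    rw [hm1, one_mul]; exact hcv _
  have hden_ge : 1 - v ≤ 1 - ⟪m, b⟫ := by linarith [(abs_le.1 hmb).2]
  have hden_pos : 0 < 1 - ⟪m, b⟫ := lt_of_lt_of_le h1v hden_ge
  set Nu : ℝ := ⟪m, e⟫ with hNu_def
  set De : ℝ := s * (1 - ⟪m, b⟫) with hDe_def
  have hDe_pos : 0 < De := mul_pos hpos hden_pos
  have hsv : 0 < s * (1 - v) := mul_pos hpos h1v
  have hDe_ge : s * (1 - v) ≤ De := mul_le_mul_of_nonneg_left hden_ge hpos.le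
  have hDe_inv_le : De⁻¹ ≤ (s * (1 - v))⁻¹ := by
    rw [inv_le_inv₀ hDe_pos hsv]; exact hDe_ge
  have hNu_le : |Nu| ≤ A * s ^ 2 := by
    refine (abs_real_inner_le_norm _ _).trans ?_
    rw [hm1, one_mul]; exact hηA
  -- (i) the unit vector field
  obtain ⟨Lm, hLm, hLm_le⟩ := exists_hasFDerivAt_unitVec (x := x) (y := y) hyx
  -- (ii) `η(s)`, `c′(s)`, `s`, `s⁻¹` through the distance
  have hηd : HasDerivAt η e' s := (hη.differentiable one_ne_zero _).hasDerivAt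
  have hc1 : ContDiff ℝ 1 (deriv c) :=
    (contDiff_succ_iff_deriv.1 (show ContDiff ℝ (1 + 1) c by rw [one_add_one_eq_two]; exact hc)).2.2
  have hcd : HasDerivAt (deriv c) b' s := (hc1.differentiable one_ne_zero _).hasDerivAt
  have hLη : HasFDerivAt (fun y' : E3 ↦ η ‖y' - x‖) (Ls.smulRight e') y :=
    hasFDerivAt_comp_dist hηd hyx
  have hLc : HasFDerivAt (fun y' : E3 ↦ deriv c ‖y' - x‖) (Ls.smulRight b') y :=
    hasFDerivAt_comp_dist hcd hyx
  have hLinv : HasFDerivAt (fun y' : E3 ↦ (‖y' - x‖)⁻¹) ((-(s ^ 2)⁻¹) • Ls) y :=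
    hasFDerivAt_dist_inv hyx
  have hLdist : HasFDerivAt (fun y' : E3 ↦ ‖y' - x‖) Ls y := hasFDerivAt_dist hyx
  -- (iii) `P₁ = s⁻¹ • η(s)`
  set LP1 : E3 →L[ℝ] E3 := s⁻¹ • Ls.smulRight e' + ((-(s ^ 2)⁻¹) • Ls).smulRight e with hLP1
  have hP1 : HasFDerivAt (fun y' : E3 ↦ (‖y' - x‖)⁻¹ • η ‖y' - x‖) LP1 y := hLinv.smul hLη
  -- (iv) `Nu = ⟪m, η(s)⟫`, `De = s (1 - ⟪m, c′(s)⟫)`, `Q = Nu * De⁻¹`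
  set LNu : E3 →L[ℝ] ℝ := (fderivInnerCLM ℝ (m, e)).comp (Lm.prod (Ls.smulRight e')) with hLNu
  set LIn : E3 →L[ℝ] ℝ := (fderivInnerCLM ℝ (m, b)).comp (Lm.prod (Ls.smulRight b')) with hLIn
  have hNu : HasFDerivAt (fun y' : E3 ↦ ⟪(‖y' - x‖)⁻¹ • (y' - x), η ‖y' - x‖⟫) LNu y :=
    hLm.inner ℝ hLη
  have hIn : HasFDerivAt (fun y' : E3 ↦ ⟪(‖y' - x‖)⁻¹ • (y' - x), deriv c ‖y' - x‖⟫) LIn y :=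
    hLm.inner ℝ hLc
  set LDe : E3 →L[ℝ] ℝ := s • (-LIn) + (1 - ⟪m, b⟫) • Ls with hLDe
  have hDe : HasFDerivAt (fun y' : E3 ↦ ‖y' - x‖ *
      (1 - ⟪(‖y' - x‖)⁻¹ • (y' - x), deriv c ‖y' - x‖⟫)) LDe y :=
    hLdist.mul (hIn.const_sub 1)
  set LDi : E3 →L[ℝ] ℝ := (-(De ^ 2)⁻¹) • LDe with hLDi
  have hDeinv : HasFDerivAt (fun y' : E3 ↦ (‖y' - x‖ *
      (1 - ⟪(‖y' - x‖)⁻¹ • (y' - x), deriv c ‖y' - x‖⟫))⁻¹) LDi y :=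
    (hasDerivAt_inv hDe_pos.ne').comp_hasFDerivAt y hDe
  set LQ : E3 →L[ℝ] ℝ := Nu • LDi + De⁻¹ • LNu with hLQ
  have hQ : HasFDerivAt (fun y' : E3 ↦ ⟪(‖y' - x‖)⁻¹ • (y' - x), η ‖y' - x‖⟫ * (‖y' - x‖ *
      (1 - ⟪(‖y' - x‖)⁻¹ • (y' - x), deriv c ‖y' - x‖⟫))⁻¹) LQ y :=
    hNu.mul hDeinv
  -- (v) `P₂ = Q • c′(s)` and the field
  set LP2 : E3 →L[ℝ] E3 := (Nu * De⁻¹) • Ls.smulRight b' + LQ.smulRight b with hLP2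
  have hP2 : HasFDerivAt (fun y' : E3 ↦ (⟪(‖y' - x‖)⁻¹ • (y' - x), η ‖y' - x‖⟫ * (‖y' - x‖ *
      (1 - ⟪(‖y' - x‖)⁻¹ • (y' - x), deriv c ‖y' - x‖⟫))⁻¹) • deriv c ‖y' - x‖) LP2 y :=
    hQ.smul hLc
  have hF : HasFDerivAt (fun y' : E3 ↦ (‖y' - x‖)⁻¹ • η ‖y' - x‖ +
      (⟪(‖y' - x‖)⁻¹ • (y' - x), η ‖y' - x‖⟫ *
        (‖y' - x‖ * (1 - ⟪(‖y' - x‖)⁻¹ • (y' - x), deriv c ‖y' - x‖⟫))⁻¹) • deriv c ‖y' - x‖)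
      (LP1 + LP2) y := hP1.add hP2
  refine ⟨LP1 + LP2, hF, fun w ↦ ?_⟩
  have hLsw : ‖Ls w‖ ≤ ‖w‖ := norm_distCLM_apply_le x y w
  have hLmw : ‖Lm w‖ ≤ 2 / s * ‖w‖ := hLm_le w
  have hbs : ‖b‖ ≤ v := hcv s
  have hb's : ‖b'‖ ≤ A := hcA s
  have h1v1 : 1 - v ≤ 1 := by linarith
  have h1v2 : (1 - v) ^ 2 ≤ 1 - v := by nlinarith
  -- component estimates
  have hLNu_le : |LNu w| ≤ 3 * A * s * ‖w‖ := by
    simp only [hLNu, ContinuousLinearMap.comp_apply, ContinuousLinearMap.prod_apply,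
      fderivInnerCLM_apply, ContinuousLinearMap.smulRight_apply]
    calc |⟪m, Ls w • e'⟫ + ⟪Lm w, e⟫|
        ≤ |⟪m, Ls w • e'⟫| + |⟪Lm w, e⟫| := abs_add_le _ _
      _ ≤ ‖m‖ * ‖Ls w • e'‖ + ‖Lm w‖ * ‖e‖ :=
          add_le_add (abs_real_inner_le_norm _ _) (abs_real_inner_le_norm _ _)
      _ ≤ 1 * (‖w‖ * (A * s)) + (2 / s * ‖w‖) * (A * s ^ 2) := by
          rw [hm1]
          refine add_le_add ?_ (mul_le_mul hLmw hηA (norm_nonneg _) (by positivity))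
          rw [norm_smul, one_mul, one_mul]
          exact mul_le_mul hLsw hη'A (norm_nonneg _) (norm_nonneg _)
      _ = 3 * A * s * ‖w‖ := by field_simp; norm_num
  have hLDe_le : |LDe w| ≤ (4 + A * s) * ‖w‖ := by
    have happ : LDe w = s * -(⟪m, Ls w • b'⟫ + ⟪Lm w, b⟫) + (1 - ⟪m, b⟫) * Ls w := by
      simp only [hLDe, hLIn, add_apply, FunLike.coe_smul,
        Pi.smul_apply, neg_apply, ContinuousLinearMap.comp_apply,
        ContinuousLinearMap.prod_apply, fderivInnerCLM_apply, ContinuousLinearMap.smulRight_apply,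
        smul_eq_mul]
    rw [happ]
    have h1 : |⟪m, Ls w • b'⟫| ≤ ‖w‖ * A := by
      refine (abs_real_inner_le_norm _ _).trans ?_
      rw [hm1, one_mul, norm_smul]
      exact mul_le_mul hLsw hb's (norm_nonneg _) (norm_nonneg _)
    have h2 : |⟪Lm w, b⟫| ≤ 2 / s * ‖w‖ * v :=
      (abs_real_inner_le_norm _ _).trans (mul_le_mul hLmw hbs (norm_nonneg _) (by positivity))
    have h3 : |(1 - ⟪m, b⟫) * Ls w| ≤ (1 + v) * ‖w‖ := by
      rw [abs_mul]
      refine mul_le_mul ?_ hLsw (abs_nonneg _) (by linarith)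
      have := (abs_le.1 hmb).1
      rw [abs_le]; constructor <;> linarith
    calc |s * -(⟪m, Ls w • b'⟫ + ⟪Lm w, b⟫) + (1 - ⟪m, b⟫) * Ls w|
        ≤ |s * -(⟪m, Ls w • b'⟫ + ⟪Lm w, b⟫)| + |(1 - ⟪m, b⟫) * Ls w| := abs_add_le _ _
      _ ≤ s * (‖w‖ * A + 2 / s * ‖w‖ * v) + (1 + v) * ‖w‖ := by
          refine add_le_add ?_ h3
          rw [abs_mul, abs_of_pos hpos, abs_neg]
          exact mul_le_mul_of_nonneg_left ((abs_add_le _ _).trans (add_le_add h1 h2)) hpos.le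
      _ = (1 + 3 * v + A * s) * ‖w‖ := by field_simp; ring
      _ ≤ (4 + A * s) * ‖w‖ := by gcongr; linarith
  have hLDi_le : |LDi w| ≤ (De ^ 2)⁻¹ * ((4 + A * s) * ‖w‖) := by
    have happ : LDi w = -(De ^ 2)⁻¹ * LDe w := by
      simp only [hLDi, FunLike.coe_smul, Pi.smul_apply, smul_eq_mul]
    rw [happ, abs_mul, abs_neg, abs_inv, abs_pow, abs_of_pos hDe_pos]
    exact mul_le_mul_of_nonneg_left hLDe_le (by positivity)
  have hDe2 : ((s * (1 - v)) ^ 2) ≤ De ^ 2 := pow_le_pow_left₀ hsv.le hDe_ge 2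
  have hLQ_le : |LQ w| ≤ (7 * A + A ^ 2 * s) / (1 - v) ^ 2 * ‖w‖ := by
    have happ : LQ w = Nu * LDi w + De⁻¹ * LNu w := by
      simp only [hLQ, add_apply, FunLike.coe_smul, Pi.smul_apply,
        smul_eq_mul]
    rw [happ]
    have hA1 : |Nu * LDi w| ≤ A * (4 + A * s) / (1 - v) ^ 2 * ‖w‖ := by
      rw [abs_mul]
      calc |Nu| * |LDi w| ≤ (A * s ^ 2) * ((De ^ 2)⁻¹ * ((4 + A * s) * ‖w‖)) :=
            mul_le_mul hNu_le hLDi_le (abs_nonneg _) (by positivity)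
        _ ≤ (A * s ^ 2) * (((s * (1 - v)) ^ 2)⁻¹ * ((4 + A * s) * ‖w‖)) := by
            refine mul_le_mul_of_nonneg_left (mul_le_mul_of_nonneg_right ?_ (by positivity))
              (by positivity)
            rw [inv_le_inv₀ (by positivity) (by positivity)]
            exact hDe2
        _ = A * (4 + A * s) / (1 - v) ^ 2 * ‖w‖ := by field_simp
    have hA2 : |De⁻¹ * LNu w| ≤ 3 * A / (1 - v) * ‖w‖ := by
      rw [abs_mul, abs_inv, abs_of_pos hDe_pos]
      calc De⁻¹ * |LNu w| ≤ (s * (1 - v))⁻¹ * (3 * A * s * ‖w‖) :=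
            mul_le_mul hDe_inv_le hLNu_le (abs_nonneg _) (by positivity)
        _ = 3 * A / (1 - v) * ‖w‖ := by field_simp
    have hA3 : 3 * A / (1 - v) * ‖w‖ ≤ 3 * A / (1 - v) ^ 2 * ‖w‖ := by
      refine mul_le_mul_of_nonneg_right ?_ (norm_nonneg _)
      exact div_le_div_of_nonneg_left (by positivity) (by positivity) h1v2
    calc |Nu * LDi w + De⁻¹ * LNu w| ≤ |Nu * LDi w| + |De⁻¹ * LNu w| := abs_add_le _ _
      _ ≤ A * (4 + A * s) / (1 - v) ^ 2 * ‖w‖ + 3 * A / (1 - v) ^ 2 * ‖w‖ :=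
          add_le_add hA1 (hA2.trans hA3)
      _ = (7 * A + A ^ 2 * s) / (1 - v) ^ 2 * ‖w‖ := by ring
  have hLP1_le : ‖LP1 w‖ ≤ 2 * A * ‖w‖ := by
    have happ : LP1 w = s⁻¹ • Ls w • e' + (-(s ^ 2)⁻¹ * Ls w) • e := by
      simp only [hLP1, add_apply, FunLike.coe_smul, Pi.smul_apply,
        ContinuousLinearMap.smulRight_apply, smul_eq_mul]
    rw [happ]
    calc ‖s⁻¹ • Ls w • e' + (-(s ^ 2)⁻¹ * Ls w) • e‖
        ≤ ‖s⁻¹ • Ls w • e'‖ + ‖(-(s ^ 2)⁻¹ * Ls w) • e‖ := norm_add_le _ _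
      _ ≤ s⁻¹ * (‖w‖ * (A * s)) + (s ^ 2)⁻¹ * ‖w‖ * (A * s ^ 2) := by
          refine add_le_add ?_ ?_
          · rw [norm_smul, norm_inv, norm_norm, norm_smul]
            refine mul_le_mul_of_nonneg_left ?_ (by positivity)
            exact mul_le_mul hLsw hη'A (norm_nonneg _) (norm_nonneg _)
          · rw [norm_smul, norm_mul, norm_neg, norm_inv, norm_pow, norm_norm]
            exact mul_le_mul (mul_le_mul_of_nonneg_left hLsw (by positivity)) hηA (norm_nonneg _)
              (by positivity)
      _ = 2 * A * ‖w‖ := by field_simp; ring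
  have hQ_le : |Nu * De⁻¹| ≤ A * s / (1 - v) := by
    rw [abs_mul, abs_inv, abs_of_pos hDe_pos]
    calc |Nu| * De⁻¹ ≤ (A * s ^ 2) * (s * (1 - v))⁻¹ :=
          mul_le_mul hNu_le hDe_inv_le (inv_nonneg.2 hDe_pos.le) (by positivity)
      _ = A * s / (1 - v) := by field_simp
  have hQ_le' : |Nu * De⁻¹| ≤ A * s / (1 - v) ^ 2 :=
    hQ_le.trans (div_le_div_of_nonneg_left (by positivity) (by positivity) h1v2)
  have hLP2_le : ‖LP2 w‖ ≤ (7 * A + 2 * A ^ 2 * s) / (1 - v) ^ 2 * ‖w‖ := by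
    have happ : LP2 w = (Nu * De⁻¹) • Ls w • b' + LQ w • b := by
      simp only [hLP2, add_apply, FunLike.coe_smul, Pi.smul_apply,
        ContinuousLinearMap.smulRight_apply]
    rw [happ]
    calc ‖(Nu * De⁻¹) • Ls w • b' + LQ w • b‖
        ≤ ‖(Nu * De⁻¹) • Ls w • b'‖ + ‖LQ w • b‖ := norm_add_le _ _
      _ ≤ (A * s / (1 - v) ^ 2) * (‖w‖ * A) + ((7 * A + A ^ 2 * s) / (1 - v) ^ 2 * ‖w‖) * 1 := by
          refine add_le_add ?_ ?_
          · rw [norm_smul, Real.norm_eq_abs, norm_smul]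
            exact mul_le_mul hQ_le' (mul_le_mul hLsw hb's (norm_nonneg _) (norm_nonneg _))
              (by positivity) (by positivity)
          · rw [norm_smul, Real.norm_eq_abs]
            exact mul_le_mul hLQ_le (hbs.trans hv1.le) (norm_nonneg _) (by positivity)
      _ = (7 * A + 2 * A ^ 2 * s) / (1 - v) ^ 2 * ‖w‖ := by ring
  have h2A : 2 * A * ‖w‖ ≤ 2 * A / (1 - v) ^ 2 * ‖w‖ :=
    mul_le_mul_of_nonneg_right (le_div_self (by positivity) (by positivity) (h1v2.trans h1v1))
      (norm_nonneg _)
  calc ‖(LP1 + LP2) w‖ = ‖LP1 w + LP2 w‖ := by rw [add_apply]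
    _ ≤ ‖LP1 w‖ + ‖LP2 w‖ := norm_add_le _ _
    _ ≤ 2 * A / (1 - v) ^ 2 * ‖w‖ + (7 * A + 2 * A ^ 2 * s) / (1 - v) ^ 2 * ‖w‖ :=
        add_le_add (hLP1_le.trans h2A) hLP2_le
    _ = (9 * A + 2 * A ^ 2 * s) / (1 - v) ^ 2 * ‖w‖ := by ring

end Bound

/-! ### Registered form -/

/-- **Derivative bound for the Sherman–Morrison transport field** (registered helper of
stmt-FinalStateConjecture-17402, brick `FarConeRetardationRemainder`). [folklore] -/
theorem farCone_field_fderiv_bound : ∀ (c η : ℝ → EuclideanSpace ℝ (Fin 3)) (x y : EuclideanSpace ℝ (Fin 3)) (v A : ℝ), ContDiff ℝ 2 c → ContDiff ℝ 1 η → 0 ≤ v → v < 1 → 0 ≤ A → (∀ s, ‖deriv c s‖ ≤ v) → (∀ s, ‖deriv (deriv c) s‖ ≤ A) → ‖η ‖y - x‖‖ ≤ A * ‖y - x‖ ^ 2 → ‖deriv η ‖y - x‖‖ ≤ A * ‖y - x‖ → y ≠ x → ∃ L : EuclideanSpace ℝ (Fin 3) →L[ℝ] EuclideanSpace ℝ (Fin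 3), HasFDerivAt (fun y' : EuclideanSpace ℝ (Fin 3) ↦ (‖y' - x‖)⁻¹ • η ‖y' - x‖ + (inner ℝ ((‖y' - x‖)⁻¹ • (y' - x)) (η ‖y' - x‖) * (‖y' - x‖ * (1 - inner ℝ ((‖y' - x‖)⁻¹ • (y' - x)) (deriv c ‖y' - x‖)))⁻¹) • deriv c ‖y' - x‖) L y ∧ ∀ w, ‖L w‖ ≤ (9 * A + 2 * A ^ 2 * ‖y - x‖) / (1 - v) ^ 2 * ‖w‖ :=
  fun _c _η _x _y _v _A hc hη hv0 hv1 hA hcv hcA hηA hη'A hyx ↦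
    exists_hasFDerivAt_field_bound hc hη hv0 hv1 hA hcv hcA hηA hη'A hyx

end Summit.FinalStateConjecture.FinalStateConjecture.Theorems.EIHFluxBalance.ModulatedKerrHandoffBricks.FarCone

end
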